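import Mathlib
import Summits.NavierStokesRegularity.NavierStokesRegularity.Theorems.EulerZoomLiouvillePowerGaugeEulerLiouvilleBackwardPoincare
import Literature.Analysis.FluidPDE.CKNInterpolationEstimate
import HarnessLib

/-!
# Scale-explicit `L⁶` and cubic bounds on balls of `ℝ³` — tools for the window flux bound of the crux
# `EulerZoomLiouville.PowerGaugeEulerLiouville` (successor target #1 of the lead's line `birth`)

Route `EulerZoomLiouville` (NavierStokesRegularity), crux E = stmt-NavierStokesRegularity-19832
`PowerGaugeEulerLiouville`.  The lead's finite-backward-flux stratum (`…Flux.lean`) and its from-rest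
corollary (`…FromRest.lean`) reduce the in-window rung «no Euler collapse from rest for 5/11 < ρ ≤ 1/2» to a
WINDOW flux bound `∫_{(α,β)×ℝ³} (|u|³ + 2|p||u|)/max(1,|x|) < ∞` from the gauges.  Its first input is the
slice-wise, SCALE-EXPLICIT Sobolev/interpolation inequality on balls (the full-cylinder CKN interpolation
`exists_cknC_le_rpow` loses the window and only reaches `ρ > 2/3`):

* `exists_eLpNorm_six_le_ball_explicit` — there is an absolute `C` with
  `‖f‖_{L⁶(B(x₀,r))} ≤ C ‖g‖_{L²(B)} + |B|^{−1/3} ‖f‖_{L²(B)}` for `f, g ∈ L²(B)`, `g` a weak derivative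
  of `f` on `B` (tree `exists_eLpNorm_sub_average_le_ball` at `p = 2 → p' = 6` + Jensen for the mean);
* `lintegral_cube_le_ball_explicit` — hence `∫_B ‖f‖³ ≤ ‖f‖₂^{3/2} (C‖g‖₂ + |B|^{−1/3}‖f‖₂)^{3/2}`
  (Lebesgue interpolation `∫|f|³ ≤ (∫|f|²)^{3/4} (∫|f|⁶)^{1/4}`, tree `lintegral_pow_three_le_Lp_interpolation`).

WHAT THIS IS NOT: not NS — real analysis on balls; the window/shell bookkeeping is the successor's. [folklore]
-/

noncomputable section

set_option linter.dupNamespace false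

open MeasureTheory Set Filter Topology Metric Function TopologicalSpace Module
open scoped ENNReal NNReal

namespace Summit.NavierStokesRegularity.NavierStokesRegularity.Theorems.PowerGaugeEulerLiouville

open Literature.Analysis Literature.Analysis.FunctionSpaces Literature.Analysis.FluidPDE

/-- **Scale-explicit Sobolev inequality on balls of `ℝ³`.**  There is an absolute constant `C` such that
for every ball `B = B(x₀, r)` and `f ∈ L²(B; ℝ³)` with weak derivative `g ∈ L²(B)` on `B`:
`‖f‖_{L⁶(B)} ≤ C ‖g‖_{L²(B)} + |B|^{−1/3} ‖f‖_{L²(B)}` (Poincaré–Sobolev for `f − ⨍_B f` with a constant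
independent of the ball, plus `‖⨍_B f‖_{L⁶(B)} = ‖⨍_B f‖ |B|^{1/6} ≤ |B|^{1/6 − 1/2} ‖f‖_{L²(B)}`).
[folklore] -/
theorem exists_eLpNorm_six_le_ball_explicit :
    ∃ C : ℝ≥0, ∀ (x₀ : EuclideanSpace ℝ (Fin 3)) (r : ℝ), 0 < r →
      ∀ (f : EuclideanSpace ℝ (Fin 3) → EuclideanSpace ℝ (Fin 3))
        (g : EuclideanSpace ℝ (Fin 3) → EuclideanSpace ℝ (Fin 3) →L[ℝ] EuclideanSpace ℝ (Fin 3)),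
      MemLp f 2 (volume.restrict (ball x₀ r)) → MemLp g 2 (volume.restrict (ball x₀ r)) →
      HasWeakFDerivOn (⟨ball x₀ r, isOpen_ball⟩ : Opens (EuclideanSpace ℝ (Fin 3))) volume f g →
      eLpNorm f 6 (volume.restrict (ball x₀ r)) ≤
        C * eLpNorm g 2 (volume.restrict (ball x₀ r)) +
          (volume (ball x₀ r))⁻¹ ^ (1 / 3 : ℝ) * eLpNorm f 2 (volume.restrict (ball x₀ r)) := by
  have h3 : finrank ℝ (EuclideanSpace ℝ (Fin 3)) = 3 := finrank_euclideanSpace_fin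
  obtain ⟨C, hC⟩ := exists_eLpNorm_sub_average_le_ball (E := EuclideanSpace ℝ (Fin 3))
    (F := EuclideanSpace ℝ (Fin 3)) (p := 2) (p' := 6) (by norm_num)
    (by rw [h3]; push_cast; norm_num) (by rw [h3]; push_cast; norm_num)
  refine ⟨C, fun x₀ r hr f g hf hg hW => ?_⟩
  set μ : Measure (EuclideanSpace ℝ (Fin 3)) := volume.restrict (ball x₀ r) with hμ
  haveI : IsFiniteMeasure μ := isFiniteMeasure_restrict.2 measure_ball_lt_top.ne
  have hV0 : volume (ball x₀ r) ≠ 0 := (measure_ball_pos volume x₀ hr).ne'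
  have hVtop : volume (ball x₀ r) ≠ ⊤ := measure_ball_lt_top.ne
  -- the Sobolev function
  have hfW : MemSobolevDomain 1 ((2 : ℝ≥0) : ℝ≥0∞)
      (⟨ball x₀ r, isOpen_ball⟩ : Opens (EuclideanSpace ℝ (Fin 3))) volume f := by
    refine (memSobolevDomain_succ_iff (k := 0)).2 ⟨hf, g, hW, fun v => ?_⟩
    rw [memSobolevDomain_zero_iff]
    exact Backward.memLp_clm_apply hg v
  have h1 : eLpNorm (fun x => f x - ⨍ y in ball x₀ r, f y) 6 μ ≤ C * eLpNorm g 2 μ := by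
    have := hC x₀ r hr f g hfW hW
    exact_mod_cast this
  -- the mean term: `‖⨍ f‖ |B|^{1/2} ≤ ‖f‖_{L²(B)}` (Jensen) and `‖const‖_{L⁶(B)} = ‖const‖ |B|^{1/6}`
  set m : EuclideanSpace ℝ (Fin 3) := ⨍ y in ball x₀ r, f y with hm
  have hJ : ‖m‖ₑ * volume (ball x₀ r) ^ (1 / 2 : ℝ) ≤ eLpNorm f 2 μ := by
    have := enorm_setAverage_mul_rpow_le (μ := volume) (s := ball x₀ r) hVtop (p := 2) (by norm_num)
      (h := f) hf.1
    simpa using this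
  have hμ0 : μ ≠ 0 := by
    rw [hμ]; intro h; exact hV0 (Measure.restrict_eq_zero.1 h)
  have hconst : eLpNorm (fun _ : EuclideanSpace ℝ (Fin 3) => m) 6 μ = ‖m‖ₑ * volume (ball x₀ r) ^ (1 / 6 : ℝ) := by
    rw [eLpNorm_const _ (by norm_num) hμ0, hμ, Measure.restrict_apply_univ]
    norm_num
  have h2 : eLpNorm (fun _ : EuclideanSpace ℝ (Fin 3) => m) 6 μ ≤
      (volume (ball x₀ r))⁻¹ ^ (1 / 3 : ℝ) * eLpNorm f 2 μ := by
    rw [hconst]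
    -- `‖m‖ |B|^{1/6} = (|B|^{-1/3}) · (‖m‖ |B|^{1/2})`
    have e : ‖m‖ₑ * volume (ball x₀ r) ^ (1 / 6 : ℝ) =
        (volume (ball x₀ r))⁻¹ ^ (1 / 3 : ℝ) * (‖m‖ₑ * volume (ball x₀ r) ^ (1 / 2 : ℝ)) := by
      rw [ENNReal.inv_rpow, ← ENNReal.rpow_neg]
      rw [show ‖m‖ₑ * volume (ball x₀ r) ^ (1 / 6 : ℝ) =
        ‖m‖ₑ * (volume (ball x₀ r) ^ (-(1 / 3 : ℝ)) * volume (ball x₀ r) ^ (1 / 2 : ℝ)) by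
          rw [← ENNReal.rpow_add _ _ hV0 hVtop]; norm_num]
      ring
    rw [e]
    gcongr
  -- triangle inequality
  have hsplit : f = (fun x => f x - m) + fun _ => m := by funext x; simp
  calc eLpNorm f 6 μ = eLpNorm ((fun x => f x - m) + fun _ => m) 6 μ := by rw [← hsplit]
    _ ≤ eLpNorm (fun x => f x - m) 6 μ + eLpNorm (fun _ : EuclideanSpace ℝ (Fin 3) => m) 6 μ :=
        eLpNorm_add_le (hf.1.sub aestronglyMeasurable_const) aestronglyMeasurable_const (by norm_num)
    _ ≤ C * eLpNorm g 2 μ + (volume (ball x₀ r))⁻¹ ^ (1 / 3 : ℝ) * eLpNorm f 2 μ := add_le_add h1 h2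

/-- **Scale-explicit cubic interpolation on balls of `ℝ³`**: with the constant `C` of
`exists_eLpNorm_six_le_ball_explicit`, for `f, g ∈ L²(B)`, `g` a weak derivative of `f` on `B = B(x₀,r)`:
`∫_B ‖f‖³ ≤ ‖f‖_{L²(B)}^{3/2} · (C ‖g‖_{L²(B)} + |B|^{−1/3} ‖f‖_{L²(B)})^{3/2}`
(Lebesgue interpolation `∫|f|³ ≤ (∫|f|²)^{3/4}(∫|f|⁶)^{1/4}` and `(∫|f|⁶)^{1/4} = ‖f‖₆^{3/2}`). [folklore] -/
theorem lintegral_cube_le_ball_explicit :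
    ∃ C : ℝ≥0, ∀ (x₀ : EuclideanSpace ℝ (Fin 3)) (r : ℝ), 0 < r →
      ∀ (f : EuclideanSpace ℝ (Fin 3) → EuclideanSpace ℝ (Fin 3))
        (g : EuclideanSpace ℝ (Fin 3) → EuclideanSpace ℝ (Fin 3) →L[ℝ] EuclideanSpace ℝ (Fin 3)),
      MemLp f 2 (volume.restrict (ball x₀ r)) → MemLp g 2 (volume.restrict (ball x₀ r)) →
      HasWeakFDerivOn (⟨ball x₀ r, isOpen_ball⟩ : Opens (EuclideanSpace ℝ (Fin 3))) volume f g →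
      ∫⁻ x in ball x₀ r, ‖f x‖ₑ ^ (3 : ℕ) ≤
        eLpNorm f 2 (volume.restrict (ball x₀ r)) ^ (3 / 2 : ℝ) *
          (C * eLpNorm g 2 (volume.restrict (ball x₀ r)) +
            (volume (ball x₀ r))⁻¹ ^ (1 / 3 : ℝ) * eLpNorm f 2 (volume.restrict (ball x₀ r))) ^ (3 / 2 : ℝ) := by
  obtain ⟨C, hC⟩ := exists_eLpNorm_six_le_ball_explicit
  refine ⟨C, fun x₀ r hr f g hf hg hW => ?_⟩
  set μ : Measure (EuclideanSpace ℝ (Fin 3)) := volume.restrict (ball x₀ r) with hμ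
  have h6 := hC x₀ r hr f g hf hg hW
  have hint := lintegral_pow_three_le_Lp_interpolation μ (f := fun x => ‖f x‖ₑ) hf.1.aemeasurable.enorm
  -- `(∫ ‖f‖²)^{3/4} = ‖f‖₂^{3/2}` and `(∫ ‖f‖⁶)^{1/4} = ‖f‖₆^{3/2}`
  have epow : ∀ x, ‖f x‖ₑ ^ (2 : ℕ) = ‖f x‖ₑ ^ (2 : ℝ) := fun x => by
    rw [← ENNReal.rpow_natCast]; norm_num
  have e2 : (∫⁻ x, ‖f x‖ₑ ^ (2 : ℕ) ∂μ) ^ (3 / 4 : ℝ) = eLpNorm f 2 μ ^ (3 / 2 : ℝ) := by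
    rw [eLpNorm_eq_lintegral_rpow_enorm_toReal (by norm_num) (by norm_num)]
    simp only [ENNReal.toReal_ofNat, one_div, epow]
    rw [← ENNReal.rpow_mul]
    norm_num
  have e6 : (∫⁻ x, ‖f x‖ₑ ^ (6 : ℝ) ∂μ) ^ (1 / 4 : ℝ) = eLpNorm f 6 μ ^ (3 / 2 : ℝ) := by
    rw [eLpNorm_eq_lintegral_rpow_enorm_toReal (by norm_num) (by norm_num)]
    simp only [ENNReal.toReal_ofNat, one_div]
    rw [← ENNReal.rpow_mul]
    norm_num
  rw [e2, e6] at hint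
  refine hint.trans ?_
  gcongr

end Summit.NavierStokesRegularity.NavierStokesRegularity.Theorems.PowerGaugeEulerLiouville

end
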